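import Summits.Ventures.CertifiedQuantumChemistry.Rows.SingletGapCertificateCodimOne
import HarnessLib

/-!
# Ventures/CertifiedQuantumChemistry — Rows/SingletTempleRows.lean: TEMPLE'S INEQUALITY ON THE SINGLET
# SUBSPACE `K = (n, n)-sector ∩ ker Ŝ_+` — certified SINGLET lower rows and brackets
# `E₀(Ĥ_F; N = 2n, S = 0)` from a gap leg on `K` and ONE exact singlet witness (HYPOTHESES-M1OS (T))

HONEST FRAMING (verbatim): certified bounds for a stated model Hamiltonian in a stated basis; not a
claim about the real molecule or material beyond that model.

Typer chem-type-09 (LADDER-CHEM I-TYPE slot 09, custody of `Rows/Temple*` / `Rows/GapCertificate*`), the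
`K`-twin of solver-6's `Rows/TempleLowerRow.lean` (p470245: `TempleCertificate`, `lowerRow_of_temple`) for
chem-idea-1's `solver/gap-temple/HYPOTHESES-M1OS.md` v0.2 (T): «ψ ∈ K a singlet trial (an SU(2)-symmetric
MPS is in K exactly), ρ := ⟨ψ, Ĥ_F ψ⟩, v := ⟨ψ, Ĥ_F² ψ⟩ − ρ², ρ < ℓ ⇒ E₀^K(F) ≥ ρ − v/(ℓ − ρ) (Temple 1928),
and E₀^K ≤ ρ. E₀^K = the singlet ground energy = the R2 quantity for the XS pair.» The gap leg on `K`
(`SingletGapCertificate` / `SingletGapCertificateCodimOne`, `Rows/SingletGapCertificateCodimOne.lean`) comes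
from the level-shift deflation producer (G) there.

## Contents (one `def` — a certificate SHAPE, nothing asserted; everything else PROVED, 0 sorry)
* `SingletTempleCertificate F n lo β` — solver-6's `TempleCertificate` with the witness in `K`: a nonzero
  `ψ ∈ singletSector k n` with exact moments `A = Re⟨ψ, Ĥψ⟩`, `B = Re⟨ψ, Ĥ²ψ⟩`, `nn = ⟨ψ, ψ⟩`, `A < β·nn`,
  `lo·(β·nn − A) ≤ β·A − B`.
* `singletLowerRow_of_temple` — `SingletGapCertificate F n β` + `SingletTempleCertificate F n lo β` ⇒
  `SingletLowerRow F n lo` (Temple's inequality `templeInequality_holds` on the `Ĥ(F)`-invariant `K`, the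
  witness normalised exactly as in `lowerRow_of_temple`); `…_codimOne` (downgrade first).
* `singletUpperRow_of_temple_witness` (Rayleigh–Ritz on `K`), `singletBracket_of_temple_witness(_codimOne)` —
  BOTH sides of `E₀(Ĥ_F; N = 2n, S = 0)` from ONE exact singlet witness; and the end-to-end statement
  `singletBracket_of_lowerRow_shift_temple` ((n1)+(n2)+(n3)+(T) of HYPOTHESES-M1OS in one theorem).
CAVEAT (chem-type-06's finding, 2026-08-27T02:50Z): an `S_z`-blocked MPS export of an `SU(2)` run is in the
sector but NOT in `K` exactly — for such a spin-contaminated trial use chem-type-06's (J′) slot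
(`Rows/SingletGroundStateOverlapRows.lean`), not this file; here `ψ ∈ K` is a hypothesis.
References: Reed–Simon IV Thm XIII.5 (Temple) [cite: ReedSimonIV1978, Thm XIII.5]; Horn–Johnson (2013)
Thm 4.2.6 [cite: HornJohnson2013, Thm 4.2.6].
-/

noncomputable section

namespace Summit.Ventures.CertifiedQuantumChemistry

open Matrix Finset
open Literature.MathematicalPhysics.QuantumLattice Literature.MathematicalPhysics.QuantumChemistry
open Literature.MathematicalPhysics.QuantumLattice.EigenvalueContinuation
open scoped ComplexOrder

variable {k : ℕ}

/-! ## §1 The Temple certificate on `K` -/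

/-- **TEMPLE CERTIFICATE ON `K`** (HYPOTHESES-M1OS (T)): an explicit NONZERO vector `ψ` of the singlet
subspace (an exact singlet trial — e.g. an `SU(2)`-symmetric MPS or a spin-adapted integer CI vector)
whose exact moments `A = Re⟨ψ, Ĥψ⟩`, `B = Re⟨ψ, Ĥ²ψ⟩`, `nn = ⟨ψ, ψ⟩` satisfy `A < β·nn` and
`lo·(β·nn − A) ≤ β·A − B` — solver-6's `TempleCertificate` with `ψ ∈ K`. [cite: ReedSimonIV1978, Thm XIII.5] -/
def SingletTempleCertificate (F : Model k) (n : ℕ) (lo β : ℚ) : Prop :=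
  ∃ ψ : Fock (Orb (Fin k)), ψ ∈ singletSector k n ∧ ψ ≠ 0 ∧
    (star ψ ⬝ᵥ F.hamiltonian *ᵥ ψ).re < ((β : ℚ) : ℝ) * (star ψ ⬝ᵥ ψ).re ∧
    ((lo : ℚ) : ℝ) * (((β : ℚ) : ℝ) * (star ψ ⬝ᵥ ψ).re - (star ψ ⬝ᵥ F.hamiltonian *ᵥ ψ).re) ≤
      ((β : ℚ) : ℝ) * (star ψ ⬝ᵥ F.hamiltonian *ᵥ ψ).re -
        (star ψ ⬝ᵥ (F.hamiltonian * F.hamiltonian) *ᵥ ψ).re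

/-! ## §2 (T): Temple's inequality on `K` — certified singlet lower rows and brackets -/

/-- **TEMPLE LOWER ROW ON `K`** (HYPOTHESES-M1OS (T)): for a symmetric model, a spectral gap leg on the
singlet subspace `SingletGapCertificate F n β` and a Temple certificate on `K` (`SingletTempleCertificate
F n lo β`: a nonzero `ψ ∈ K` with exact moments, `A < β·nn`, `lo·(β·nn − A) ≤ β·A − B`) give the SINGLET
lower row `SingletLowerRow F n lo`, i.e. `lo ≤ E₀(Ĥ_F; N = 2n, S = 0)` — Temple's inequality
(`templeInequality_holds`, Reed–Simon IV Thm XIII.5) on the `Ĥ(F)`-invariant subspace `K`, the witness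
normalised as in solver-6's `lowerRow_of_temple`. [cite: ReedSimonIV1978, Thm XIII.5] -/
theorem singletLowerRow_of_temple {F : Model k} (hF : F.IsSymmetric) {n : ℕ} {lo β : ℚ}
    (hG : SingletGapCertificate F n β) (hT : SingletTempleCertificate F n lo β) : SingletLowerRow F n lo := by
  obtain ⟨ψ, hψK, hψ0, hlt, hle⟩ := hT
  have hH : F.hamiltonian.IsHermitian := Model.hamiltonian_isHermitian hF
  have hψs : IsInSector n n ψ := ((mem_singletSector_iff_isInSector ψ).1 hψK).1
  obtain ⟨hn, -⟩ := range_of_isInSector_ne_zero hψs hψ0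
  refine ⟨hn, ?_⟩
  set K : Submodule ℂ (Fock (Orb (Fin k))) := singletSector k n with hKdef
  have hKH : ∀ v ∈ K, F.hamiltonian *ᵥ v ∈ K := fun v hv => F.hamiltonian_mulVec_mem_singletSector hv
  have hE : F.singletEnergy n = F.hamiltonian.minEnergyOn K := rfl
  -- the gap hypothesis in Temple's form
  have hgap : ∀ (e : ℝ) (v : Fock (Orb (Fin k))), v ∈ K → v ≠ 0 →
      F.hamiltonian *ᵥ v = (e : ℂ) • v → e ≠ F.hamiltonian.minEnergyOn K → ((β : ℚ) : ℝ) ≤ e :=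
    fun e v hv hv0 hHv hne => hG e v hv hv0 hHv (hE ▸ hne)
  -- normalise the witness
  obtain ⟨c, hc, hcc, h1⟩ := exists_normalize hψ0
  have hψ'K : ((c : ℂ) • ψ) ∈ K := K.smul_mem _ hψK
  set A : ℝ := (star ψ ⬝ᵥ F.hamiltonian *ᵥ ψ).re with hAdef
  set B : ℝ := (star ψ ⬝ᵥ (F.hamiltonian * F.hamiltonian) *ᵥ ψ).re with hBdef
  set nn : ℝ := (star ψ ⬝ᵥ ψ).re with hndef
  set β' : ℝ := ((β : ℚ) : ℝ) with hβ'def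
  have hct : 0 < c * c := mul_pos hc hc
  have hρ' : (star ((c : ℂ) • ψ) ⬝ᵥ F.hamiltonian *ᵥ ((c : ℂ) • ψ)).re = c * c * A :=
    re_star_smul_dotProduct_mulVec_smul _ c ψ
  have hm' : (star ((c : ℂ) • ψ) ⬝ᵥ (F.hamiltonian * F.hamiltonian) *ᵥ ((c : ℂ) • ψ)).re =
      c * c * B :=
    re_star_smul_dotProduct_mulVec_smul _ c ψ
  have hlt' : c * c * A < β' := by
    have h := mul_lt_mul_of_pos_left hlt hct
    calc c * c * A < c * c * (β' * nn) := h
      _ = β' * (c * c * nn) := by ring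
      _ = β' := by rw [hcc, mul_one]
  -- Temple's inequality for the unit vector `c • ψ` on `K`
  have hT := templeInequality_holds F.hamiltonian hH K hKH β' hgap ((c : ℂ) • ψ) hψ'K h1
    (by rw [hρ']; exact hlt')
  rw [hρ', hm'] at hT
  rw [hE]
  refine le_trans ?_ hT
  have hpos : 0 < β' - c * c * A := sub_pos.2 hlt'
  have hne0 : β' - c * c * A ≠ 0 := hpos.ne'
  have hX : c * c * A - (c * c * B - (c * c * A) ^ 2) / (β' - c * c * A) =
      (β' * (c * c * A) - c * c * B) / (β' - c * c * A) := by
    rw [eq_div_iff hne0, sub_mul, div_mul_cancel₀ _ hne0]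
    ring
  rw [hX, le_div_iff₀ hpos]
  have h2 := mul_le_mul_of_nonneg_left hle hct.le
  have h3 : ((lo : ℚ) : ℝ) * (β' - c * c * A) = c * c * (((lo : ℚ) : ℝ) * (β' * nn - A)) := by
    have : β' = β' * (c * c * nn) := by rw [hcc, mul_one]
    conv_lhs => rw [this]
    ring
  rw [h3]
  refine h2.trans (le_of_eq ?_)
  ring

/-- **Temple lower row on `K` under the codimension-one certificate** (downgrade first).
[cite: ReedSimonIV1978, Thm XIII.5] -/
theorem singletLowerRow_of_temple_codimOne {F : Model k} (hF : F.IsSymmetric) {n : ℕ} {lo β : ℚ}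
    (hG : SingletGapCertificateCodimOne F n β) (hT : SingletTempleCertificate F n lo β) :
    SingletLowerRow F n lo :=
  singletLowerRow_of_temple hF (hG.singletGapCertificate hF) hT

/-- **The singlet witness carries its own UPPER row** (Rayleigh–Ritz on `K`, `Rows/SingletRows.lean`
`singletUpperRow_of_certificate`): `ψ ∈ K`, `ψ ≠ 0`, `A ≤ hi·nn` ⇒ `SingletUpperRow F n hi`.
[cite: ReedSimonIV1978, Thm XIII.5] -/
theorem singletUpperRow_of_temple_witness {F : Model k} (hF : F.IsSymmetric) {n : ℕ} {hi : ℚ}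
    {ψ : Fock (Orb (Fin k))} (hψK : ψ ∈ singletSector k n) (hψ0 : ψ ≠ 0)
    (hu : (star ψ ⬝ᵥ F.hamiltonian *ᵥ ψ).re ≤ ((hi : ℚ) : ℝ) * (star ψ ⬝ᵥ ψ).re) :
    SingletUpperRow F n hi :=
  singletUpperRow_of_certificate hF
    ⟨ψ, ((mem_singletSector_iff_isInSector ψ).1 hψK).1, ((mem_singletSector_iff_isInSector ψ).1 hψK).2,
      hψ0, hu⟩

/-- **TWO-SIDED SINGLET BRACKET FROM ONE EXACT SINGLET WITNESS** (HYPOTHESES-M1OS (T): «E₀^K ≥ ρ − v/(ℓ − ρ)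
and E₀^K ≤ ρ»): `SingletGapCertificate F n β`, a nonzero `ψ ∈ K` with exact moments `A`, `B`, `nn`,
`A < β·nn`, `lo·(β·nn − A) ≤ β·A − B` and `A ≤ hi·nn` ⇒ `SingletBracket F n lo hi` — both sides of
`E₀(Ĥ_F; N = 2n, S = 0)`, the R2 quantity of an open-shell-singlet pair, from ONE state.
[cite: ReedSimonIV1978, Thm XIII.5] -/
theorem singletBracket_of_temple_witness {F : Model k} (hF : F.IsSymmetric) {n : ℕ} {lo hi β : ℚ}
    (hG : SingletGapCertificate F n β) {ψ : Fock (Orb (Fin k))} (hψK : ψ ∈ singletSector k n)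
    (hψ0 : ψ ≠ 0) (hlt : (star ψ ⬝ᵥ F.hamiltonian *ᵥ ψ).re < ((β : ℚ) : ℝ) * (star ψ ⬝ᵥ ψ).re)
    (hle : ((lo : ℚ) : ℝ) * (((β : ℚ) : ℝ) * (star ψ ⬝ᵥ ψ).re - (star ψ ⬝ᵥ F.hamiltonian *ᵥ ψ).re) ≤
      ((β : ℚ) : ℝ) * (star ψ ⬝ᵥ F.hamiltonian *ᵥ ψ).re -
        (star ψ ⬝ᵥ (F.hamiltonian * F.hamiltonian) *ᵥ ψ).re)
    (hu : (star ψ ⬝ᵥ F.hamiltonian *ᵥ ψ).re ≤ ((hi : ℚ) : ℝ) * (star ψ ⬝ᵥ ψ).re) :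
    SingletBracket F n lo hi :=
  ⟨singletLowerRow_of_temple hF hG ⟨ψ, hψK, hψ0, hlt, hle⟩, singletUpperRow_of_temple_witness hF hψK hψ0 hu⟩

/-- The same bracket under the codimension-one certificate on `K`. [cite: ReedSimonIV1978, Thm XIII.5] -/
theorem singletBracket_of_temple_witness_codimOne {F : Model k} (hF : F.IsSymmetric) {n : ℕ}
    {lo hi β : ℚ} (hG : SingletGapCertificateCodimOne F n β) {ψ : Fock (Orb (Fin k))}
    (hψK : ψ ∈ singletSector k n) (hψ0 : ψ ≠ 0)
    (hlt : (star ψ ⬝ᵥ F.hamiltonian *ᵥ ψ).re < ((β : ℚ) : ℝ) * (star ψ ⬝ᵥ ψ).re)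
    (hle : ((lo : ℚ) : ℝ) * (((β : ℚ) : ℝ) * (star ψ ⬝ᵥ ψ).re - (star ψ ⬝ᵥ F.hamiltonian *ᵥ ψ).re) ≤
      ((β : ℚ) : ℝ) * (star ψ ⬝ᵥ F.hamiltonian *ᵥ ψ).re -
        (star ψ ⬝ᵥ (F.hamiltonian * F.hamiltonian) *ᵥ ψ).re)
    (hu : (star ψ ⬝ᵥ F.hamiltonian *ᵥ ψ).re ≤ ((hi : ℚ) : ℝ) * (star ψ ⬝ᵥ ψ).re) :
    SingletBracket F n lo hi :=
  singletBracket_of_temple_witness hF (hG.singletGapCertificate hF) hψK hψ0 hlt hle hu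

/-- **END-TO-END (n1)+(n2)+(n3)+(T) ⇒ the singlet bracket**: the deflator form bound on `K ∩ Φ^⊥`, an
ordinary lower row of the shifted file, and one exact singlet Temple witness with `A < (ℓ − λc)·nn` give
`SingletBracket F n lo hi` — the whole open-shell-singlet chain of HYPOTHESES-M1OS in one statement.
[cite: ReedSimonIV1978, Thm XIII.5] -/
theorem singletBracket_of_lowerRow_shift_temple {F S : Model k} (hF : F.IsSymmetric) (hS : S.IsSymmetric)
    {n : ℕ} {lam : ℚ} (hlam : 0 ≤ lam) (v : Fock (Orb (Fin k))) {c ℓ lo hi : ℚ}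
    (hSform : ∀ x : Fock (Orb (Fin k)), IsInSector n n x → spinPlus *ᵥ x = 0 → star v ⬝ᵥ x = 0 →
      (star x ⬝ᵥ S.hamiltonian *ᵥ x).re ≤ ((c : ℚ) : ℝ) * (star x ⬝ᵥ x).re)
    (hL : LowerRow (Model.lincomb 1 lam F S) n n ℓ) {ψ : Fock (Orb (Fin k))}
    (hψK : ψ ∈ singletSector k n) (hψ0 : ψ ≠ 0)
    (hlt : (star ψ ⬝ᵥ F.hamiltonian *ᵥ ψ).re < (((ℓ - lam * c : ℚ) : ℚ) : ℝ) * (star ψ ⬝ᵥ ψ).re)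
    (hle : ((lo : ℚ) : ℝ) * ((((ℓ - lam * c : ℚ) : ℚ) : ℝ) * (star ψ ⬝ᵥ ψ).re -
        (star ψ ⬝ᵥ F.hamiltonian *ᵥ ψ).re) ≤
      (((ℓ - lam * c : ℚ) : ℚ) : ℝ) * (star ψ ⬝ᵥ F.hamiltonian *ᵥ ψ).re -
        (star ψ ⬝ᵥ (F.hamiltonian * F.hamiltonian) *ᵥ ψ).re)
    (hu : (star ψ ⬝ᵥ F.hamiltonian *ᵥ ψ).re ≤ ((hi : ℚ) : ℝ) * (star ψ ⬝ᵥ ψ).re) :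
    SingletBracket F n lo hi :=
  singletBracket_of_temple_witness_codimOne hF
    (singletGapCertificateCodimOne_of_lowerRow_shift hF hS hlam v hSform hL) hψK hψ0 hlt hle hu

end Summit.Ventures.CertifiedQuantumChemistry

end
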